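import Summits.Ventures.FusionMHD.Bench.SolovevPCFIterMercierQ3Subst
import HarnessLib

/-!
# F1 / MERCIER on the INTERIOR flux surface `ρ = 3 / 4·ρ_edge` of the ITER-like PCF Solov'ev equilibrium — KERNEL BRIDGE 2/2: the
# g-free `t`-integrals of model-5's GGJ input record on the ρ = 3 / 4·ρ_edge loop equal rational multiples of the certified `K…m`
(venture LADDER-GRIDFUSION, rung F1.MERCIER-profile; cell `gridfusion`, seat `gridfusion-sos-6` (g3), 2026-08-27.)

Same architecture as the edge bridge `…MercierEdge{Subst,Integrals1,Integrals2}` (ITER-like p488688/p489017/p489609, NSTX-like p490356/p490793), now for the interior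
Lee–Cerfon surface `r = 3 / 4·a` (`ρ = 3 / 4·ρ_edge`): the §1 half-angle substitution of
the edge file is reused (`open … (theta …)`); §0 positivity of the surface polynomials `UpQ3/UmQ3/PpQ3/PmQ3` of the Data files
 on `[0,1]`; §2 dictionary `u(θ) = U₊`, `|∇Ψ|²·u = 4αρ²P(cos t)`, `w = κ₀/(2c√u)`; §3 the SEVEN g-free atomic
integrals that the exact quadratic structure (`SolovevFluxSurfaceGGJQuadratic`, p493204) requires:
`T1 ∫w = (κ₀/c)K₁`, `T2 ∫∂w/∂r = −(κ₀R_a/c)K₂`, `T4 ∫lcQKernelDr = −3R_aK₃`, `T5 ∫w/G = κ₀K₆/(c·4αρ²)`,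
`T6a ∫w/(uG) = κ₀K₇/(c·4αρ²)`, `T6b ∫w/u = (κ₀/c)K₄`, `T9 ∫uw/G = κ₀K₈/(c·4αρ²)` — no g-dependent integral is needed.
The threshold file `…MercierQ3Threshold.lean` turns these into the two-sided certified Mercier threshold of the surface.
HONEST FRAMING: CERTIFIED kernel identities about the MODEL (ideal MHD, analytic fixed-boundary PCF Solov'ev equilibrium
[cite: PatakiCerfonFreidberg2013, §6.1]); nothing here says a plasma or device is stable. No `decide` in this file.
-/

noncomputable section

open Real MeasureTheory Set intervalIntegral
open Literature.Analysis.ValidatedNumerics Literature.Analysis.ValidatedNumerics.PolyMP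
open Literature.Analysis.ValidatedNumerics.ExpPoly (Poly)
open Literature.MathematicalPhysics.MHD Literature.MathematicalPhysics.MHD.Solovev
open Summit.Ventures.FusionMHD.Models.SolovevPCF

namespace Summit.Ventures.FusionMHD.Bench.SolovevPCFIter.MercierQ3

open Summit.Ventures.FusionMHD.Bench.SolovevPCFIter.MercierEdge (theta theta_arg_sq theta_arg_lt_one cos_theta
  sin_sq_theta theta_zero theta_one continuous_theta hasDerivAt_theta integral_zero_pi_eq_theta integral_zero_two_pi_eq
  integral_zero_two_pi_eq_theta eval_const_two sqrt_two_sub_pos uIcc01)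
open Summit.Ventures.FusionMHD.Bench.SolovevPCFIter.MercierEdge (splus sminus lcAmp_eq)

/-! ## §3 The nine atomic `t`-integrals of the GGJ input bridge as the certified `w`-integrals

Abbreviations in the docstrings: `κ₀, R_a, q₀(g), a = ε/R_a` the Lee–Cerfon parameters of the ITER-like instance
(`IterLike.psi_eq_psiLC`), `c = 2257675225/6032287802 = 1/2 + 4d₃`, `u, w, G` = `lcU, lcAvgWeight, lcGradSq` on the edge
loop, `K₁…K₈, KX, KY` the certified reals of `…MercierEdgeData1/2`, `…Averages` (`K₄ = edgeI`). -/

section atomic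

variable {g : ℝ} (hg : 0 < g)
include hg

/-- Positivity package on the ρ = 3 / 4·ρ_edge loop (`u, G > 0`). [folklore] -/
theorem lcGradSq_q3_pos (t : ℝ) :
    0 < lcGradSq IterLike.kappa0 g IterLike.Ra (IterLike.q0 g) (IterLike.ε / IterLike.Ra * (3 / 4)) t :=
  lcGradSq_pos IterLike.Ra_pos IterLike.kappa0_pos hg (IterLike.q0_pos hg) q3_minorRadius.1
    q3_minorRadius.2 t

omit hg in
/-- Continuity of `u`. [folklore] -/
theorem continuous_lcU_q3 : Continuous (lcU IterLike.Ra (IterLike.ε / IterLike.Ra * (3 / 4))) := by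
  unfold lcU; fun_prop

omit hg in
/-- Non-vanishing denominators on the ρ = 3 / 4·ρ_edge loop (for `fun_prop`). [folklore] -/
theorem q3_denoms_ne (t : ℝ) :
    lcU IterLike.Ra (IterLike.ε / IterLike.Ra * (3 / 4)) t ≠ 0
    ∧ lcU IterLike.Ra (IterLike.ε / IterLike.Ra * (3 / 4)) t * Real.sqrt (lcU IterLike.Ra (IterLike.ε / IterLike.Ra * (3 / 4)) t) ≠ 0
    ∧ lcU IterLike.Ra (IterLike.ε / IterLike.Ra * (3 / 4)) t ^ 2 * Real.sqrt (lcU IterLike.Ra (IterLike.ε / IterLike.Ra * (3 / 4)) t) ≠ 0 := by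
  have hu := lcU_q3_pos t
  have hs := Real.sqrt_pos.2 hu
  exact ⟨hu.ne', by positivity, by positivity⟩

/-- Continuity of `w`. [folklore] -/
theorem continuous_w_q3 :
    Continuous (lcAvgWeight IterLike.kappa0 g IterLike.Ra (IterLike.q0 g) (IterLike.ε / IterLike.Ra * (3 / 4))) :=
  continuous_lcAvgWeight IterLike.Ra_pos IterLike.kappa0_pos hg (IterLike.q0_pos hg)
    q3_minorRadius.1.le q3_minorRadius.2

omit hg in
/-- Continuity of `G = |∇Ψ|²` along the loop (generic lemma of `SolovevFluxSurfaceGGJQuadratic`). [folklore] -/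
theorem continuous_lcGradSq_q3 :
    Continuous (lcGradSq IterLike.kappa0 g IterLike.Ra (IterLike.q0 g) (IterLike.ε / IterLike.Ra * (3 / 4))) :=
  continuous_lcGradSq IterLike.Ra_pos q3_minorRadius.1 q3_minorRadius.2

/-- `T1`: `∫₀^{2π} w dt = (κ₀/c)·K₁`. [folklore] -/
theorem integral_w_q3 :
    ∫ t in (0 : ℝ)..(2 * π), lcAvgWeight IterLike.kappa0 g IterLike.Ra (IterLike.q0 g) (IterLike.ε / IterLike.Ra * (3 / 4)) t
      = IterLike.kappa0 / (2257675225 / 6032287802 : ℝ) * K1q3 := by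
  have hg' := hg.ne'
  rw [integral_zero_two_pi_eq_theta _ (continuous_w_q3 hg)
    (fun t => by rw [lcAvgWeight_q3 hg', lcAvgWeight_q3 hg', lcU_two_pi_sub])]
  have key : ∀ w ∈ uIcc (0:ℝ) 1,
      (lcAvgWeight IterLike.kappa0 g IterLike.Ra (IterLike.q0 g) (IterLike.ε / IterLike.Ra * (3 / 4)) (theta w)
        + lcAvgWeight IterLike.kappa0 g IterLike.Ra (IterLike.q0 g) (IterLike.ε / IterLike.Ra * (3 / 4)) (π - theta w))
        * (2 / Real.sqrt (2 - w ^ 2))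
      = IterLike.kappa0 / (2 * (2257675225 / 6032287802 : ℝ)) * (K1q3e.toFun w * Poly.eval [2] w) := by
    intro w hw
    rw [uIcc01] at hw
    rw [lcAvgWeight_q3 hg', lcAvgWeight_q3 hg', lcU_theta hw, lcU_pi_sub_theta hw, toFun_K1q3e,
      eval_const_two, div_eq_mul_inv 2]
    ring
  rw [integral_congr key, intervalIntegral.integral_const_mul]
  unfold K1q3
  ring

/-- `T2`: `∫₀^{2π} ∂w/∂r dt = −(κ₀R_a/c)·K₂`. [folklore] -/
theorem integral_wDr_q3 :
    ∫ t in (0 : ℝ)..(2 * π), lcAvgWeightDr IterLike.kappa0 g IterLike.Ra (IterLike.q0 g) (IterLike.ε / IterLike.Ra * (3 / 4)) t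
      = -(IterLike.kappa0 * IterLike.Ra / (2257675225 / 6032287802 : ℝ)) * K2q3 := by
  have hg' := hg.ne'
  have hc : Continuous
      (lcAvgWeightDr IterLike.kappa0 g IterLike.Ra (IterLike.q0 g) (IterLike.ε / IterLike.Ra * (3 / 4))) := by
    have e : lcAvgWeightDr IterLike.kappa0 g IterLike.Ra (IterLike.q0 g) (IterLike.ε / IterLike.Ra * (3 / 4))
        = fun t => -(IterLike.kappa0 * IterLike.Ra / (2 * (2257675225 / 6032287802 : ℝ)))
          * (Real.cos t * (lcU IterLike.Ra (IterLike.ε / IterLike.Ra * (3 / 4)) t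
              * Real.sqrt (lcU IterLike.Ra (IterLike.ε / IterLike.Ra * (3 / 4)) t))⁻¹) := by
      funext t; exact lcAvgWeightDr_q3 hg' t
    rw [e]
    have hden : ∀ t, lcU IterLike.Ra (IterLike.ε / IterLike.Ra * (3 / 4)) t
        * Real.sqrt (lcU IterLike.Ra (IterLike.ε / IterLike.Ra * (3 / 4)) t) ≠ 0 := fun t => (q3_denoms_ne t).2.1
    have cu : Continuous (lcU IterLike.Ra (IterLike.ε / IterLike.Ra * (3 / 4))) := continuous_lcU_q3
    exact continuous_const.mul (Real.continuous_cos.mul ((cu.mul cu.sqrt).fun_inv₀ hden))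
  rw [integral_zero_two_pi_eq_theta _ hc
    (fun t => by rw [lcAvgWeightDr_q3 hg', lcAvgWeightDr_q3 hg', lcU_two_pi_sub, Real.cos_two_pi_sub])]
  have key : ∀ w ∈ uIcc (0:ℝ) 1,
      (lcAvgWeightDr IterLike.kappa0 g IterLike.Ra (IterLike.q0 g) (IterLike.ε / IterLike.Ra * (3 / 4)) (theta w)
        + lcAvgWeightDr IterLike.kappa0 g IterLike.Ra (IterLike.q0 g) (IterLike.ε / IterLike.Ra * (3 / 4)) (π - theta w))
        * (2 / Real.sqrt (2 - w ^ 2))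
      = -(IterLike.kappa0 * IterLike.Ra / (2 * (2257675225 / 6032287802 : ℝ)))
          * (K2q3e.toFun w * Poly.eval [2] w) := by
    intro w hw
    rw [uIcc01] at hw
    rw [lcAvgWeightDr_q3 hg', lcAvgWeightDr_q3 hg', lcU_theta hw, lcU_pi_sub_theta hw, Real.cos_pi_sub,
      cos_theta hw, toFun_K2q3e, eval_const_two, div_eq_mul_inv 2]
    unfold splus sminus
    ring
  rw [integral_congr key, intervalIntegral.integral_const_mul]
  unfold K2q3
  ring

omit hg in
/-- `T4`: `∫₀^π lcQKernelDr dt = −3R_a·K₃`. [folklore] -/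
theorem integral_qKernelDr_q3 :
    ∫ t in (0 : ℝ)..π, lcQKernelDr IterLike.Ra (IterLike.ε / IterLike.Ra * (3 / 4)) t = -(3 * IterLike.Ra) * K3q3 := by
  have cu : Continuous (lcU IterLike.Ra (IterLike.ε / IterLike.Ra * (3 / 4))) := continuous_lcU_q3
  have hc : Continuous (lcQKernelDr IterLike.Ra (IterLike.ε / IterLike.Ra * (3 / 4))) := by
    have e : lcQKernelDr IterLike.Ra (IterLike.ε / IterLike.Ra * (3 / 4)) = fun t => -(3 * (IterLike.Ra * Real.cos t))
        / (lcU IterLike.Ra (IterLike.ε / IterLike.Ra * (3 / 4)) t ^ 2 * Real.sqrt (lcU IterLike.Ra (IterLike.ε / IterLike.Ra * (3 / 4)) t)) := by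
      funext t; rfl
    rw [e]
    have hden : ∀ t, lcU IterLike.Ra (IterLike.ε / IterLike.Ra * (3 / 4)) t ^ 2
        * Real.sqrt (lcU IterLike.Ra (IterLike.ε / IterLike.Ra * (3 / 4)) t) ≠ 0 := fun t => (q3_denoms_ne t).2.2
    fun_prop (disch := assumption)
  rw [integral_zero_pi_eq_theta _ hc]
  have key : ∀ w ∈ uIcc (0:ℝ) 1,
      (lcQKernelDr IterLike.Ra (IterLike.ε / IterLike.Ra * (3 / 4)) (theta w)
        + lcQKernelDr IterLike.Ra (IterLike.ε / IterLike.Ra * (3 / 4)) (π - theta w)) * (2 / Real.sqrt (2 - w ^ 2))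
      = -(3 * IterLike.Ra) * (K3q3e.toFun w * Poly.eval [2] w) := by
    intro w hw
    rw [uIcc01] at hw
    unfold lcQKernelDr
    rw [lcU_theta hw, lcU_pi_sub_theta hw, Real.cos_pi_sub, cos_theta hw, toFun_K3q3e, eval_const_two,
      div_eq_mul_inv 2]
    have h1 : UpQ3 w ≠ 0 := (UpQ3_pos hw).ne'
    have h2 : UmQ3 w ≠ 0 := (UmQ3_pos w).ne'
    have h3 : Real.sqrt (UpQ3 w) ≠ 0 := (Real.sqrt_pos.2 (UpQ3_pos hw)).ne'
    have h4 : Real.sqrt (UmQ3 w) ≠ 0 := (Real.sqrt_pos.2 (UmQ3_pos w)).ne'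
    have h5 : Real.sqrt (2 - w ^ 2) ≠ 0 := (sqrt_two_sub_pos hw).ne'
    unfold splus sminus
    field_simp
    ring
  rw [integral_congr key, intervalIntegral.integral_const_mul]
  unfold K3q3
  ring

/-- `T5`: `∫₀^{2π} w/G dt = (κ₀/(c·4αρ²))·K₆`. [folklore] -/
theorem integral_w_div_G_q3 :
    ∫ t in (0 : ℝ)..(2 * π), lcAvgWeight IterLike.kappa0 g IterLike.Ra (IterLike.q0 g) (IterLike.ε / IterLike.Ra * (3 / 4)) t
        / lcGradSq IterLike.kappa0 g IterLike.Ra (IterLike.q0 g) (IterLike.ε / IterLike.Ra * (3 / 4)) t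
      = IterLike.kappa0 / ((2257675225 / 6032287802 : ℝ) * c4q3) * K6q3 := by
  have hg' := hg.ne'
  have hc : Continuous fun t =>
      lcAvgWeight IterLike.kappa0 g IterLike.Ra (IterLike.q0 g) (IterLike.ε / IterLike.Ra * (3 / 4)) t
        / lcGradSq IterLike.kappa0 g IterLike.Ra (IterLike.q0 g) (IterLike.ε / IterLike.Ra * (3 / 4)) t :=
    (continuous_w_q3 hg).div₀ continuous_lcGradSq_q3 fun t => (lcGradSq_q3_pos hg t).ne'
  rw [integral_zero_two_pi_eq_theta _ hc
    (fun t => by simp only [lcAvgWeight_q3 hg', lcU_two_pi_sub, lcGradSq_two_pi_sub hg'])]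
  have key : ∀ w ∈ uIcc (0:ℝ) 1,
      (lcAvgWeight IterLike.kappa0 g IterLike.Ra (IterLike.q0 g) (IterLike.ε / IterLike.Ra * (3 / 4)) (theta w)
          / lcGradSq IterLike.kappa0 g IterLike.Ra (IterLike.q0 g) (IterLike.ε / IterLike.Ra * (3 / 4)) (theta w)
        + lcAvgWeight IterLike.kappa0 g IterLike.Ra (IterLike.q0 g) (IterLike.ε / IterLike.Ra * (3 / 4)) (π - theta w)
          / lcGradSq IterLike.kappa0 g IterLike.Ra (IterLike.q0 g) (IterLike.ε / IterLike.Ra * (3 / 4)) (π - theta w))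
        * (2 / Real.sqrt (2 - w ^ 2))
      = IterLike.kappa0 / (2 * (2257675225 / 6032287802 : ℝ) * c4q3) * (K6q3e.toFun w * Poly.eval [2] w) := by
    intro w hw
    rw [uIcc01] at hw
    rw [lcAvgWeight_q3 hg', lcAvgWeight_q3 hg', lcGradSq_theta hg' hw, lcGradSq_pi_sub_theta hg' hw,
      lcU_theta hw, lcU_pi_sub_theta hw, toFun_K6q3e, eval_const_two]
    have hP1 : PpQ3 w ≠ 0 := (PpQ3_pos hw).ne'
    have hP2 : PmQ3 w ≠ 0 := (PmQ3_pos hw).ne'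
    have h5 : Real.sqrt (2 - w ^ 2) ≠ 0 := (sqrt_two_sub_pos hw).ne'
    have hc4q3 : c4q3 ≠ 0 := c4q3_pos.ne'
    set s1 := Real.sqrt (UpQ3 w) with hs1
    set s2 := Real.sqrt (UmQ3 w) with hs2
    have hU1 : UpQ3 w = s1 ^ 2 := by rw [hs1, Real.sq_sqrt (UpQ3_pos hw).le]
    have hU2 : UmQ3 w = s2 ^ 2 := by rw [hs2, Real.sq_sqrt (UmQ3_pos w).le]
    have hs1' : s1 ≠ 0 := by rw [hs1]; exact (Real.sqrt_pos.2 (UpQ3_pos hw)).ne'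
    have hs2' : s2 ≠ 0 := by rw [hs2]; exact (Real.sqrt_pos.2 (UmQ3_pos w)).ne'
    rw [hU1, hU2]
    field_simp
  rw [integral_congr key, intervalIntegral.integral_const_mul]
  unfold K6q3
  ring

/-- Continuity of `w/(uG)`. [folklore] -/
theorem continuous_w_div_uG_q3 : Continuous fun t =>
      lcAvgWeight IterLike.kappa0 g IterLike.Ra (IterLike.q0 g) (IterLike.ε / IterLike.Ra * (3 / 4)) t
        / (lcU IterLike.Ra (IterLike.ε / IterLike.Ra * (3 / 4)) t
            * lcGradSq IterLike.kappa0 g IterLike.Ra (IterLike.q0 g) (IterLike.ε / IterLike.Ra * (3 / 4)) t) :=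
  (continuous_w_q3 hg).div₀ (continuous_lcU_q3.mul continuous_lcGradSq_q3)
    fun t => mul_ne_zero (lcU_q3_pos t).ne' (lcGradSq_q3_pos hg t).ne'

/-- Continuity of `w/u`. [folklore] -/
theorem continuous_w_div_u_q3 : Continuous fun t =>
      lcAvgWeight IterLike.kappa0 g IterLike.Ra (IterLike.q0 g) (IterLike.ε / IterLike.Ra * (3 / 4)) t
        / lcU IterLike.Ra (IterLike.ε / IterLike.Ra * (3 / 4)) t :=
  (continuous_w_q3 hg).div₀ continuous_lcU_q3 fun t => (lcU_q3_pos t).ne'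

/-- `T6a`: `∫₀^{2π} w/(uG) dt = (κ₀/(c·4αρ²))·K₇`. [folklore] -/
theorem integral_w_div_uG_q3 :
    ∫ t in (0 : ℝ)..(2 * π), lcAvgWeight IterLike.kappa0 g IterLike.Ra (IterLike.q0 g) (IterLike.ε / IterLike.Ra * (3 / 4)) t
        / (lcU IterLike.Ra (IterLike.ε / IterLike.Ra * (3 / 4)) t
            * lcGradSq IterLike.kappa0 g IterLike.Ra (IterLike.q0 g) (IterLike.ε / IterLike.Ra * (3 / 4)) t)
      = IterLike.kappa0 / ((2257675225 / 6032287802 : ℝ) * c4q3) * K7q3 := by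
  have hg' := hg.ne'
  rw [integral_zero_two_pi_eq_theta _ (continuous_w_div_uG_q3 hg)
    (fun t => by simp only [lcAvgWeight_q3 hg', lcU_two_pi_sub, lcGradSq_two_pi_sub hg'])]
  have key : ∀ w ∈ uIcc (0:ℝ) 1,
      (lcAvgWeight IterLike.kappa0 g IterLike.Ra (IterLike.q0 g) (IterLike.ε / IterLike.Ra * (3 / 4)) (theta w)
          / (lcU IterLike.Ra (IterLike.ε / IterLike.Ra * (3 / 4)) (theta w)
              * lcGradSq IterLike.kappa0 g IterLike.Ra (IterLike.q0 g) (IterLike.ε / IterLike.Ra * (3 / 4)) (theta w))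
        + lcAvgWeight IterLike.kappa0 g IterLike.Ra (IterLike.q0 g) (IterLike.ε / IterLike.Ra * (3 / 4)) (π - theta w)
          / (lcU IterLike.Ra (IterLike.ε / IterLike.Ra * (3 / 4)) (π - theta w)
              * lcGradSq IterLike.kappa0 g IterLike.Ra (IterLike.q0 g) (IterLike.ε / IterLike.Ra * (3 / 4)) (π - theta w)))
        * (2 / Real.sqrt (2 - w ^ 2))
      = IterLike.kappa0 / (2 * (2257675225 / 6032287802 : ℝ) * c4q3) * (K7q3e.toFun w * Poly.eval [2] w) := by
    intro w hw
    rw [uIcc01] at hw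
    rw [lcAvgWeight_q3 hg', lcAvgWeight_q3 hg', lcGradSq_theta hg' hw, lcGradSq_pi_sub_theta hg' hw,
      lcU_theta hw, lcU_pi_sub_theta hw, toFun_K7q3e, eval_const_two]
    have hP1 : PpQ3 w ≠ 0 := (PpQ3_pos hw).ne'
    have hP2 : PmQ3 w ≠ 0 := (PmQ3_pos hw).ne'
    have hU1 : UpQ3 w ≠ 0 := (UpQ3_pos hw).ne'
    have hU2 : UmQ3 w ≠ 0 := (UmQ3_pos w).ne'
    have h3 : Real.sqrt (UpQ3 w) ≠ 0 := (Real.sqrt_pos.2 (UpQ3_pos hw)).ne'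
    have h4 : Real.sqrt (UmQ3 w) ≠ 0 := (Real.sqrt_pos.2 (UmQ3_pos w)).ne'
    have h5 : Real.sqrt (2 - w ^ 2) ≠ 0 := (sqrt_two_sub_pos hw).ne'
    have hc4q3 : c4q3 ≠ 0 := c4q3_pos.ne'
    field_simp
  rw [integral_congr key, intervalIntegral.integral_const_mul]
  unfold K7q3
  ring

/-- `T6b`: `∫₀^{2π} w/u dt = (κ₀/c)·K₄`. [folklore] -/
theorem integral_w_div_u_q3 :
    ∫ t in (0 : ℝ)..(2 * π), lcAvgWeight IterLike.kappa0 g IterLike.Ra (IterLike.q0 g) (IterLike.ε / IterLike.Ra * (3 / 4)) t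
        / lcU IterLike.Ra (IterLike.ε / IterLike.Ra * (3 / 4)) t
      = IterLike.kappa0 / (2257675225 / 6032287802 : ℝ) * K4q3 := by
  have hg' := hg.ne'
  rw [integral_zero_two_pi_eq_theta _ (continuous_w_div_u_q3 hg)
    (fun t => by simp only [lcAvgWeight_q3 hg', lcU_two_pi_sub])]
  have key : ∀ w ∈ uIcc (0:ℝ) 1,
      (lcAvgWeight IterLike.kappa0 g IterLike.Ra (IterLike.q0 g) (IterLike.ε / IterLike.Ra * (3 / 4)) (theta w)
          / lcU IterLike.Ra (IterLike.ε / IterLike.Ra * (3 / 4)) (theta w)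
        + lcAvgWeight IterLike.kappa0 g IterLike.Ra (IterLike.q0 g) (IterLike.ε / IterLike.Ra * (3 / 4)) (π - theta w)
          / lcU IterLike.Ra (IterLike.ε / IterLike.Ra * (3 / 4)) (π - theta w))
        * (2 / Real.sqrt (2 - w ^ 2))
      = IterLike.kappa0 / (2 * (2257675225 / 6032287802 : ℝ)) * (K4q3e.toFun w * Poly.eval [2] w) := by
    intro w hw
    rw [uIcc01] at hw
    rw [lcAvgWeight_q3 hg', lcAvgWeight_q3 hg', lcU_theta hw, lcU_pi_sub_theta hw, toFun_K4q3e,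
      eval_const_two]
    have hU1 : UpQ3 w ≠ 0 := (UpQ3_pos hw).ne'
    have hU2 : UmQ3 w ≠ 0 := (UmQ3_pos w).ne'
    have h3 : Real.sqrt (UpQ3 w) ≠ 0 := (Real.sqrt_pos.2 (UpQ3_pos hw)).ne'
    have h4 : Real.sqrt (UmQ3 w) ≠ 0 := (Real.sqrt_pos.2 (UmQ3_pos w)).ne'
    have h5 : Real.sqrt (2 - w ^ 2) ≠ 0 := (sqrt_two_sub_pos hw).ne'
    field_simp
  rw [integral_congr key, intervalIntegral.integral_const_mul]
  unfold K4q3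
  ring

/-- `T9`: `∫₀^{2π} u·w/G dt = (κ₀/(c·4αρ²))·K₈` (the g-free combination `⟨R²/G⟩`). [folklore] -/
theorem integral_u_div_G_q3 :
    ∫ t in (0 : ℝ)..(2 * π), lcU IterLike.Ra (IterLike.ε / IterLike.Ra * (3 / 4)) t
        / lcGradSq IterLike.kappa0 g IterLike.Ra (IterLike.q0 g) (IterLike.ε / IterLike.Ra * (3 / 4)) t
        * lcAvgWeight IterLike.kappa0 g IterLike.Ra (IterLike.q0 g) (IterLike.ε / IterLike.Ra * (3 / 4)) t
      = IterLike.kappa0 / ((2257675225 / 6032287802 : ℝ) * c4q3) * K8q3 := by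
  have hg' := hg.ne'
  have hc : Continuous fun t => lcU IterLike.Ra (IterLike.ε / IterLike.Ra * (3 / 4)) t
        / lcGradSq IterLike.kappa0 g IterLike.Ra (IterLike.q0 g) (IterLike.ε / IterLike.Ra * (3 / 4)) t
        * lcAvgWeight IterLike.kappa0 g IterLike.Ra (IterLike.q0 g) (IterLike.ε / IterLike.Ra * (3 / 4)) t :=
    (continuous_lcU_q3.div₀ continuous_lcGradSq_q3 fun t => (lcGradSq_q3_pos hg t).ne').mul (continuous_w_q3 hg)
  rw [integral_zero_two_pi_eq_theta _ hc
    (fun t => by simp only [lcAvgWeight_q3 hg', lcU_two_pi_sub, lcGradSq_two_pi_sub hg'])]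
  have key : ∀ w ∈ uIcc (0:ℝ) 1,
      (lcU IterLike.Ra (IterLike.ε / IterLike.Ra * (3 / 4)) (theta w)
          / lcGradSq IterLike.kappa0 g IterLike.Ra (IterLike.q0 g) (IterLike.ε / IterLike.Ra * (3 / 4)) (theta w)
          * lcAvgWeight IterLike.kappa0 g IterLike.Ra (IterLike.q0 g) (IterLike.ε / IterLike.Ra * (3 / 4)) (theta w)
        + lcU IterLike.Ra (IterLike.ε / IterLike.Ra * (3 / 4)) (π - theta w)
          / lcGradSq IterLike.kappa0 g IterLike.Ra (IterLike.q0 g) (IterLike.ε / IterLike.Ra * (3 / 4)) (π - theta w)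
          * lcAvgWeight IterLike.kappa0 g IterLike.Ra (IterLike.q0 g) (IterLike.ε / IterLike.Ra * (3 / 4)) (π - theta w))
        * (2 / Real.sqrt (2 - w ^ 2))
      = IterLike.kappa0 / (2 * (2257675225 / 6032287802 : ℝ) * c4q3) * (K8q3e.toFun w * Poly.eval [2] w) := by
    intro w hw
    rw [uIcc01] at hw
    rw [lcAvgWeight_q3 hg', lcAvgWeight_q3 hg', lcGradSq_theta hg' hw, lcGradSq_pi_sub_theta hg' hw,
      lcU_theta hw, lcU_pi_sub_theta hw, toFun_K8q3e, eval_const_two]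
    have hP1 : PpQ3 w ≠ 0 := (PpQ3_pos hw).ne'
    have hP2 : PmQ3 w ≠ 0 := (PmQ3_pos hw).ne'
    have h5 : Real.sqrt (2 - w ^ 2) ≠ 0 := (sqrt_two_sub_pos hw).ne'
    have hc4q3 : c4q3 ≠ 0 := c4q3_pos.ne'
    set s1 := Real.sqrt (UpQ3 w) with hs1
    set s2 := Real.sqrt (UmQ3 w) with hs2
    have hU1 : UpQ3 w = s1 ^ 2 := by rw [hs1, Real.sq_sqrt (UpQ3_pos hw).le]
    have hU2 : UmQ3 w = s2 ^ 2 := by rw [hs2, Real.sq_sqrt (UmQ3_pos w).le]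
    have hs1' : s1 ≠ 0 := by rw [hs1]; exact (Real.sqrt_pos.2 (UpQ3_pos hw)).ne'
    have hs2' : s2 ≠ 0 := by rw [hs2]; exact (Real.sqrt_pos.2 (UmQ3_pos w)).ne'
    rw [hU1, hU2]
    field_simp
  rw [integral_congr key, intervalIntegral.integral_const_mul]
  unfold K8q3
  ring

end atomic



end Summit.Ventures.FusionMHD.Bench.SolovevPCFIter.MercierQ3

end
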